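import Summits.QuantumFields.YangMills.Theorems.BalabanUVNodesN15KingModelPauliLinksTight
import Summits.QuantumFields.YangMills.Theorems.BalabanUVNodesN15KingModelLandauScaling
import Literature.Probability.LatticeModels.BoxSineHarmonic
import HarnessLib

/-!
# BalabanUVNodes ∕ N15 — THE KING-MODEL RUNG (PART Ϸ-f): THE η-RATE OF THE NON-ABELIAN CURVATURE MASS — in King's units `c = η⁻²` with constant non-commuting potentials `ασ₁`, `βσ₂`
# (lattice angles `a = αη`, `b = βη`) the Pauli pair's mass floor `η⁻²·min(sin²αη, sin²βη) → min(α², β²)` at rate `η²`, η-UNIFORMLY `≥ ⅔·min(α²,β²)`; the exact eigenvalue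
# `η⁻²·2(1 − cos βη) → β²`; the curvature `η⁻²·2|sin αη sin βη| → 2αβ`; PART Ϳ's plaquette mass `≤ 2α²β²η² → 0`; the isotropic pair meets PART Ϡ's abelian Landau floor `B∕2`
# (Track A, DAG node N15 = NE2 «η-rates of the covariance pieces»; FAN-OUT v1.1 §N15 s3 «KING-MODEL RUNG … + what the curved case adds»; count-neutral)

HONEST FRAMING.  Count-neutral (cell `pub-ymgap`, seat `pub-ymgap-dag-n15-e` g48; `--supports stmt-QuantumFields-27247 --as helper` = K3ᴬ, KEY MAP v3).  Elementary real analysis on the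
constants of PARTS Ϸ-d∕Ϸ-e; one finite torus per spacing `η` (`c = η⁻²` is King's (4.4) normalisation, [King1986] p.670; the η-rate template is Lemma 4.5 (4.38) p.674); NOT Bałaban's
`G_k(U)`; NOT a node discharge (N15 of record untouched); nothing continuum-YM ∕ ℝ⁴ ∕ OS ∕ Clay.

THE RESULTS (`α, β ≥ 0` physical potentials, `η > 0` the spacing):
* §1 `sq_sub_le_sin_sq` (`x² − x⁴∕3 ≤ sin²x`, `0 ≤ x ≤ 1`), ★★ **`abs_scaled_sin_sq_sub_le`** (`|η⁻²sin²(βη) − β²| ≤ β⁴η²∕3`, `βη ≤ 1`),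
  ★★ `abs_scaled_two_mul_one_sub_cos_sub_le` (`|η⁻²·2(1 − cos βη) − β²| ≤ 5β⁴η²∕48`, Mathlib `Real.cos_bound`);
* §2 `pauliScaled α β η := η⁻²·min(sin²αη, sin²βη)` (THE PHYSICAL MASS FLOOR of PART Ϸ-d): ★ `pauliScaled_le` (`≤ min(α²,β²)`), ★★ `pauliScaled_ge` (`≥ min(α²,β²) − (α⁴+β⁴)η²∕3`),
  ★★ **`pauliScaled_ge_uniform`** (`≥ ⅔·min(α²,β²)` whenever `αη, βη ≤ 1`: an η-UNIFORM mass), ★★★ **`tendsto_pauliScaled`** (`→ min(α², β²)` as `η → 0⁺`);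
* §3 ON THE TORUS IN PHYSICAL UNITS (Ϸ-d BY NAME at `c = η⁻²`, `a = αη`, `b = βη`): ★★★ **`re_quadForm_covLapF_pauliLink_ge_physical`** (`(m² + pauliScaled)·Σ‖v_x‖² ≤ Re⟨v,(−η⁻²Δ_W+m²)v⟩`),
  ★★ `eigenvalues_covLapF_pauliLink_ge_physical_uniform` (`λ_i ≥ m² + ⅔min(α²,β²)`, every torus, every `η ≤ 1∕max`);
* §4 THE CURVATURE AND THE TWO ROADS: `pauliCurvScaled α β η := η⁻²·2|sin αη·sin βη|` (`= c‖1 − P‖`, Ϸ-c `norm_kingPlaq_pauli_sub_self`), ★ `pauliCurvScaled_le` (`≤ 2αβ`), ★★ `tendsto_pauliCurvScaled`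
  (`→ 2αβ`: the curvature is η-uniform), ★★ **`pauli_plaq_road_scaled_le`** (PART Ϳ's mass `2η⁻²λ(1 − 2sin²αη sin²βη) ≤ 2α²β²η²`) and `tendsto_pauli_plaq_road_scaled` (`→ 0`): the plaquette road
  sees NO mass in the continuum limit, the fibre road sees `min(α²,β²) = (curvature∕2)·(min∕max)`;
* §5 ★★★ **`tendsto_scaled_exact`** (Ϸ-e's exact eigenvalue `η⁻²·2(1 − cos βη) → β²`): with §2, for the weaker link the continuum mass is PINNED at `β² = min(α,β)²` from both sides;
  ★★ **`pauli_isotropic_meets_landau`** (`α = β`: `pauliScaled α α η → α²` AND PART Ϡ-d's abelian floor `η⁻²Λ(Bη²) → B∕2 = α²` at the same curvature `B = 2α²` — the non-abelian constant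
  pair realises exactly Ϡ's «half the Landau level»).
PRIOR TREE ART (by name): Ϸ-d (`re_quadForm_covLapF_pauliLink_ge`, `eigenvalues_covLapF_pauliLink_ge`, `pauli_plaq_road_le`), Ϸ-e (`exists_eigenvalue_covLapF_pauliLink_eq`), Ϡ-a (`landauGap`), Ϡ-d
(`tendsto_landauScaled`), Ϳ-a (`plaqGap`), `Literature.Probability.LatticeModels.sin_sq_le_sq`,
Mathlib (`Real.sin_gt_sub_cube`, `Real.abs_sin_sub_sin_le`, `Real.cos_bound`, `pow_le_pow_of_le_one`, `squeeze_zero_norm'`).  Dedup (rg at filing): basename 0 files;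
needles `pauliScaled|pauliCurvScaled|abs_scaled_sin_sq_sub_le|tendsto_pauliScaled|pauli_isotropic_meets_landau` 0 tree files; dry-run `dedup.landed` caught `sin_sq_le_sq`
(≡ `Literature.Probability.LatticeModels.sin_sq_le_sq`, now IMPORTED and used) and `abs_sin_le_abs` (≡ a BalabanUV support lemma; inlined as `Real.abs_sin_sub_sin_le · 0`).  Locators: [King1986] (4.4) p.670, Lemma 4.5 (4.38) p.674, (2.12) p.653; [Balaban1985BackgroundPropagators] (3.23) p.394, (3.35)–(3.37) p.396.  0 `sorry`, 2 `def`.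
-/

noncomputable section

open scoped BigOperators ComplexConjugate ComplexOrder InnerProductSpace Topology
open Finset Matrix WithLp Filter

namespace Summit.QuantumFields.YangMills.BalabanUVNodes.N15KingModelRung.ConstantCurvature

open Literature.MathematicalPhysics.QuantumFieldTheory.Balaban1983to89.B5Prop11Plancherel (Tor unitVec chi sOf)
open Summit.QuantumFields.YangMills.BalabanUVNodes.N15KingModelRung.Covariant (covLapF fib isHermitian_covLapF)
open Summit.QuantumFields.YangMills.BalabanUVNodes.N15KingModelRung.Curvature (plaqGap)
open Summit.QuantumFields.YangMills.BalabanUVNodes.N15KingModelRung.Landau (landauGap tendsto_landauScaled)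
open Literature.Probability.LatticeModels (sin_sq_le_sq)

/-! ## §1 Elementary rates for `sin²` and `2(1 − cos)` -/

section Rates

/-- `x² − x⁴∕3 ≤ sin²x` for `0 ≤ x ≤ 1` (`sin x ≥ x − x³∕6 ≥ 0`). [folklore] -/
theorem sq_sub_le_sin_sq {x : ℝ} (h0 : 0 ≤ x) (h1 : x ≤ 1) : x ^ 2 - x ^ 4 / 3 ≤ Real.sin x ^ 2 := by
  rcases eq_or_lt_of_le h0 with hx | hx
  · rw [← hx]; simp
  · have hs := Real.sin_gt_sub_cube hx
    have hcube : 0 ≤ x * (1 - x) * (1 + x) := mul_nonneg (mul_nonneg h0 (by linarith)) (by linarith)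
    have hpos : 0 ≤ x - x ^ 3 / 6 := by nlinarith [hcube]
    have hsq : (x - x ^ 3 / 6) ^ 2 ≤ Real.sin x ^ 2 := pow_le_pow_left₀ hpos hs.le 2
    nlinarith [hsq, pow_nonneg h0 6]

/-- ★★ **THE η-RATE OF THE MASS FLOOR OF ONE LINK**: `|η⁻²·sin²(βη) − β²| ≤ β⁴η²∕3` (`β ≥ 0`, `η > 0`, `βη ≤ 1`). [cite: King1986, (4.38) p.674, (4.4) p.670] -/
theorem abs_scaled_sin_sq_sub_le {β η : ℝ} (hβ : 0 ≤ β) (hη : 0 < η) (h : β * η ≤ 1) :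
    |η⁻¹ ^ 2 * Real.sin (β * η) ^ 2 - β ^ 2| ≤ β ^ 4 * η ^ 2 / 3 := by
  have hx0 : 0 ≤ β * η := by positivity
  have hup := sin_sq_le_sq (β * η)
  have hlo := sq_sub_le_sin_sq hx0 h
  have hη2 : 0 < η ^ 2 := by positivity
  have hinv : η⁻¹ ^ 2 = (η ^ 2)⁻¹ := by rw [inv_pow]
  rw [hinv, abs_le]
  constructor
  · rw [le_sub_iff_add_le, ← div_eq_inv_mul, le_div_iff₀ hη2]; nlinarith
  · rw [sub_le_iff_le_add, ← div_eq_inv_mul, div_le_iff₀ hη2]; nlinarith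

/-- ★★ **THE η-RATE OF THE EXACT EIGENVALUE**: `|η⁻²·2(1 − cos(βη)) − β²| ≤ 5β⁴η²∕48` (`βη ≤ 1`; Mathlib `Real.cos_bound`). [cite: King1986, (4.38) p.674, (4.4) p.670] -/
theorem abs_scaled_two_mul_one_sub_cos_sub_le {β η : ℝ} (hβ : 0 ≤ β) (hη : 0 < η) (h : β * η ≤ 1) :
    |η⁻¹ ^ 2 * (2 * (1 - Real.cos (β * η))) - β ^ 2| ≤ 5 * β ^ 4 * η ^ 2 / 48 := by
  have hx0 : 0 ≤ β * η := by positivity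
  have hcb := Real.cos_bound (x := β * η) (by rwa [abs_of_nonneg hx0])
  rw [abs_of_nonneg hx0] at hcb
  have hη2 : 0 < η ^ 2 := by positivity
  have hkey : η⁻¹ ^ 2 * (2 * (1 - Real.cos (β * η))) - β ^ 2 = -(2 * (η ^ 2)⁻¹) * (Real.cos (β * η) - (1 - (β * η) ^ 2 / 2)) := by
    rw [inv_pow]; field_simp; ring
  rw [hkey, abs_mul, abs_neg, abs_of_pos (by positivity : (0 : ℝ) < 2 * (η ^ 2)⁻¹)]
  calc 2 * (η ^ 2)⁻¹ * |Real.cos (β * η) - (1 - (β * η) ^ 2 / 2)| ≤ 2 * (η ^ 2)⁻¹ * ((β * η) ^ 4 * (5 / 96)) :=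
        mul_le_mul_of_nonneg_left hcb (by positivity)
    _ = 5 * β ^ 4 * η ^ 2 / 48 := by field_simp; ring

end Rates

/-! ## §2 The physical mass floor of the Pauli pair -/

section Floor

/-- THE PHYSICAL MASS FLOOR of the Pauli pair in King's units: `c·min(sin²a, sin²b)` with `c = η⁻²`, `a = αη`, `b = βη`. [cite: King1986, (4.4) p.670, (4.38) p.674] -/
def pauliScaled (α β η : ℝ) : ℝ := η⁻¹ ^ 2 * min (Real.sin (α * η) ^ 2) (Real.sin (β * η) ^ 2)

/-- ★ `pauliScaled ≤ min(α², β²)` (`sin²x ≤ x²`). [cite: King1986, (4.38) p.674] -/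
theorem pauliScaled_le {α β η : ℝ} (hη : 0 < η) : pauliScaled α β η ≤ min (α ^ 2) (β ^ 2) := by
  unfold pauliScaled
  have hη2 : 0 < η ^ 2 := by positivity
  have ha := sin_sq_le_sq (α * η)
  have hb := sin_sq_le_sq (β * η)
  rw [inv_pow, ← div_eq_inv_mul, div_le_iff₀ hη2, min_mul_of_nonneg _ _ hη2.le]
  exact min_le_min (by nlinarith) (by nlinarith)

/-- ★★ `pauliScaled ≥ min(α², β²) − (α⁴ + β⁴)η²∕3` (`α, β ≥ 0`, `αη, βη ≤ 1`). [cite: King1986, (4.38) p.674] -/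
theorem pauliScaled_ge {α β η : ℝ} (hα : 0 ≤ α) (hβ : 0 ≤ β) (hη : 0 < η) (ha : α * η ≤ 1) (hb : β * η ≤ 1) :
    min (α ^ 2) (β ^ 2) - (α ^ 4 + β ^ 4) * η ^ 2 / 3 ≤ pauliScaled α β η := by
  unfold pauliScaled
  have hη2 : 0 < η ^ 2 := by positivity
  have hla := sq_sub_le_sin_sq (by positivity : 0 ≤ α * η) ha
  have hlb := sq_sub_le_sin_sq (by positivity : 0 ≤ β * η) hb
  rw [inv_pow, ← div_eq_inv_mul, le_div_iff₀ hη2]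
  rcases le_total (Real.sin (α * η) ^ 2) (Real.sin (β * η) ^ 2) with hmin | hmin
  · rw [min_eq_left hmin]
    nlinarith [min_le_left (α ^ 2) (β ^ 2), pow_nonneg hβ 4, pow_nonneg hη.le 2, mul_nonneg (pow_nonneg hβ 4) (pow_nonneg hη.le 4)]
  · rw [min_eq_right hmin]
    nlinarith [min_le_right (α ^ 2) (β ^ 2), pow_nonneg hα 4, pow_nonneg hη.le 2, mul_nonneg (pow_nonneg hα 4) (pow_nonneg hη.le 4)]

/-- ★★ **AN η-UNIFORM MASS**: `pauliScaled ≥ ⅔·min(α², β²)` whenever `αη ≤ 1` and `βη ≤ 1` (`x² − x⁴∕3 ≥ ⅔x²` on `[0,1]`). [cite: King1986, (4.38) p.674, (4.4) p.670] -/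
theorem pauliScaled_ge_uniform {α β η : ℝ} (hα : 0 ≤ α) (hβ : 0 ≤ β) (hη : 0 < η) (ha : α * η ≤ 1) (hb : β * η ≤ 1) :
    2 / 3 * min (α ^ 2) (β ^ 2) ≤ pauliScaled α β η := by
  unfold pauliScaled
  have hη2 : 0 < η ^ 2 := by positivity
  have hla := sq_sub_le_sin_sq (by positivity : 0 ≤ α * η) ha
  have hlb := sq_sub_le_sin_sq (by positivity : 0 ≤ β * η) hb
  have ha4 : (α * η) ^ 4 ≤ (α * η) ^ 2 := pow_le_pow_of_le_one (by positivity) ha (by norm_num)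
  have hb4 : (β * η) ^ 4 ≤ (β * η) ^ 2 := pow_le_pow_of_le_one (by positivity) hb (by norm_num)
  rw [inv_pow, ← div_eq_inv_mul, le_div_iff₀ hη2]
  rcases le_total (Real.sin (α * η) ^ 2) (Real.sin (β * η) ^ 2) with hmin | hmin
  · rw [min_eq_left hmin]; nlinarith [min_le_left (α ^ 2) (β ^ 2)]
  · rw [min_eq_right hmin]; nlinarith [min_le_right (α ^ 2) (β ^ 2)]

/-- ★★★ **THE CONTINUUM LIMIT OF THE NON-ABELIAN CURVATURE MASS**: `pauliScaled α β η → min(α², β²)` as `η → 0⁺` (`α, β ≥ 0`). [cite: King1986, (4.38) p.674, (4.4) p.670] -/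
theorem tendsto_pauliScaled {α β : ℝ} (hα : 0 ≤ α) (hβ : 0 ≤ β) : Tendsto (fun η : ℝ => pauliScaled α β η) (𝓝[>] 0) (𝓝 (min (α ^ 2) (β ^ 2))) := by
  have hmaj : Tendsto (fun η : ℝ => (α ^ 4 + β ^ 4) * η ^ 2 / 3) (𝓝[>] 0) (𝓝 0) := by
    have hc : Continuous fun η : ℝ => (α ^ 4 + β ^ 4) * η ^ 2 / 3 := by continuity
    have h := hc.tendsto 0
    simp only [zero_pow (by norm_num : (2 : ℕ) ≠ 0), mul_zero, zero_div] at h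
    exact tendsto_nhdsWithin_of_tendsto_nhds h
  have hev : ∀ᶠ η : ℝ in 𝓝[>] 0, 0 < η ∧ α * η ≤ 1 ∧ β * η ≤ 1 := by
    have h1 : ∀ᶠ η : ℝ in 𝓝[>] 0, 0 < η := self_mem_nhdsWithin
    have h2 : ∀ᶠ η : ℝ in 𝓝 (0 : ℝ), α * η ≤ 1 ∧ β * η ≤ 1 := by
      have hca : Continuous fun η : ℝ => α * η := by continuity
      have hcb : Continuous fun η : ℝ => β * η := by continuity
      have hta := hca.tendsto 0; have htb := hcb.tendsto 0
      simp only [mul_zero] at hta htb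
      exact (hta.eventually (eventually_le_nhds zero_lt_one)).and (htb.eventually (eventually_le_nhds zero_lt_one))
    exact h1.and (mem_nhdsWithin_of_mem_nhds h2)
  have hbound : ∀ᶠ η : ℝ in 𝓝[>] 0, ‖pauliScaled α β η - min (α ^ 2) (β ^ 2)‖ ≤ (α ^ 4 + β ^ 4) * η ^ 2 / 3 :=
    hev.mono fun η h => by
      rw [Real.norm_eq_abs, abs_le]
      constructor
      · have := pauliScaled_ge hα hβ h.1 h.2.1 h.2.2; linarith
      · have := pauliScaled_le (α := α) (β := β) h.1; have : 0 ≤ (α ^ 4 + β ^ 4) * η ^ 2 / 3 := by positivity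
        linarith
  have h := squeeze_zero_norm' hbound hmaj
  rw [← tendsto_sub_nhds_zero_iff]; exact h

end Floor

/-! ## §3 On the torus, in physical units -/

section Torus

variable {d : ℕ} (K : Fin (d + 1) → ℕ) [hK : ∀ μ, NeZero (K μ)]

/-- ★★★ **THE GAP IN PHYSICAL UNITS**: with `c = η⁻²`, `a = αη`, `b = βη` (constant potentials `ασ₁`, `βσ₂`), on EVERY torus
`(m² + pauliScaled α β η)·Σ_x‖v_x‖² ≤ Re⟨v, (−η⁻²Δ_W + m²)v⟩` (PART Ϸ-d BY NAME). [cite: King1986, (4.4) p.670, (4.38) p.674; Balaban1985BackgroundPropagators, (3.23) p.394] -/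
theorem re_quadForm_covLapF_pauliLink_ge_physical {η : ℝ} (hη : 0 < η) (m2 α β : ℝ) {ν₀ ν₁ : Fin (d + 1)} (hν : ν₀ ≠ ν₁) (v : Tor K × Fin 2 → ℂ) :
    (m2 + pauliScaled α β η) * ∑ x, ‖fib K v x‖ ^ 2 ≤ RCLike.re (star v ⬝ᵥ (covLapF K (η⁻¹ ^ 2) m2 (kingConstLink K (pauliLink (α * η) (β * η) ν₀ ν₁)) *ᵥ v)) :=
  re_quadForm_covLapF_pauliLink_ge K (by positivity) m2 (α * η) (β * η) hν v

/-- ★★ **η-UNIFORM SPECTRAL FLOOR**: every eigenvalue of `−η⁻²Δ_W + m²` is `≥ m² + ⅔·min(α², β²)` on every torus, for every spacing with `αη, βη ≤ 1` (`α, β ≥ 0`).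
[cite: King1986, (4.4) p.670, (4.38) p.674; Balaban1985BackgroundPropagators, (3.23) p.394] -/
theorem eigenvalues_covLapF_pauliLink_ge_physical_uniform {η α β : ℝ} (hη : 0 < η) (hα : 0 ≤ α) (hβ : 0 ≤ β) (ha : α * η ≤ 1) (hb : β * η ≤ 1) (m2 : ℝ)
    {ν₀ ν₁ : Fin (d + 1)} (hν : ν₀ ≠ ν₁) (i : Tor K × Fin 2) :
    m2 + 2 / 3 * min (α ^ 2) (β ^ 2) ≤ (isHermitian_covLapF K (η⁻¹ ^ 2) m2 (kingConstLink K (pauliLink (α * η) (β * η) ν₀ ν₁))).eigenvalues i := by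
  have h := eigenvalues_covLapF_pauliLink_ge K (by positivity : (0 : ℝ) ≤ η⁻¹ ^ 2) m2 (α * η) (β * η) hν i
  have hu := pauliScaled_ge_uniform hα hβ hη ha hb
  unfold pauliScaled at hu
  linarith

end Torus

/-! ## §4 The curvature and PART Ϳ's road, in physical units -/

section Curvature

/-- THE PHYSICAL CURVATURE of the Pauli pair: `c·‖1 − P‖ = η⁻²·2|sin αη·sin βη|` (PART Ϸ-c `norm_kingPlaq_pauli_sub_self`). [cite: King1986, (2.12) p.653, (4.4) p.670] -/
def pauliCurvScaled (α β η : ℝ) : ℝ := η⁻¹ ^ 2 * (2 * |Real.sin (α * η) * Real.sin (β * η)|)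

/-- ★ `pauliCurvScaled ≤ 2αβ` (`α, β ≥ 0`). [cite: King1986, (2.12) p.653] -/
theorem pauliCurvScaled_le {α β η : ℝ} (hα : 0 ≤ α) (hβ : 0 ≤ β) (hη : 0 < η) : pauliCurvScaled α β η ≤ 2 * α * β := by
  unfold pauliCurvScaled
  have hη2 : 0 < η ^ 2 := by positivity
  have ha : |Real.sin (α * η)| ≤ |α * η| := by simpa using Real.abs_sin_sub_sin_le (α * η) 0
  have hb : |Real.sin (β * η)| ≤ |β * η| := by simpa using Real.abs_sin_sub_sin_le (β * η) 0
  rw [abs_of_nonneg (by positivity : 0 ≤ α * η)] at ha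
  rw [abs_of_nonneg (by positivity : 0 ≤ β * η)] at hb
  rw [abs_mul, inv_pow, ← div_eq_inv_mul, div_le_iff₀ hη2]
  nlinarith [abs_nonneg (Real.sin (α * η)), abs_nonneg (Real.sin (β * η)), mul_le_mul ha hb (abs_nonneg _) (by positivity)]

/-- `2αβ − pauliCurvScaled ≤ (α³β + αβ³)η²∕6·2`: a lower bound from `sin x ≥ x − x³∕6` (`αη, βη ≤ 1`). [cite: King1986, (2.12) p.653, (4.38) p.674] -/
theorem pauliCurvScaled_ge {α β η : ℝ} (hα : 0 ≤ α) (hβ : 0 ≤ β) (hη : 0 < η) (ha : α * η ≤ 1) (hb : β * η ≤ 1) :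
    2 * α * β - (α ^ 3 * β + α * β ^ 3) * η ^ 2 / 3 ≤ pauliCurvScaled α β η := by
  unfold pauliCurvScaled
  have hη2 : 0 < η ^ 2 := by positivity
  have hxa : 0 ≤ α * η := by positivity
  have hxb : 0 ≤ β * η := by positivity
  -- `sin x ≥ x − x³∕6 ≥ 0` on `[0,1]`
  have hsa : α * η - (α * η) ^ 3 / 6 ≤ Real.sin (α * η) := by
    rcases eq_or_lt_of_le hxa with h | h
    · rw [← h]; simp
    · exact (Real.sin_gt_sub_cube h).le
  have hsb : β * η - (β * η) ^ 3 / 6 ≤ Real.sin (β * η) := by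
    rcases eq_or_lt_of_le hxb with h | h
    · rw [← h]; simp
    · exact (Real.sin_gt_sub_cube h).le
  have hca : 0 ≤ (α * η) * (1 - α * η) * (1 + α * η) := mul_nonneg (mul_nonneg hxa (by linarith)) (by linarith)
  have hcb : 0 ≤ (β * η) * (1 - β * η) * (1 + β * η) := mul_nonneg (mul_nonneg hxb (by linarith)) (by linarith)
  have hpa : 0 ≤ α * η - (α * η) ^ 3 / 6 := by nlinarith [hca]
  have hpb : 0 ≤ β * η - (β * η) ^ 3 / 6 := by nlinarith [hcb]
  have hprod : (α * η - (α * η) ^ 3 / 6) * (β * η - (β * η) ^ 3 / 6) ≤ |Real.sin (α * η) * Real.sin (β * η)| := by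
    rw [abs_mul]
    exact mul_le_mul (hsa.trans (le_abs_self _)) (hsb.trans (le_abs_self _)) hpb (abs_nonneg _)
  rw [inv_pow, ← div_eq_inv_mul, le_div_iff₀ hη2]
  nlinarith [hprod, mul_nonneg (pow_nonneg hα 3) (pow_nonneg hβ 3), pow_nonneg hη.le 6, mul_nonneg (mul_nonneg (pow_nonneg hα 3) (pow_nonneg hβ 3)) (pow_nonneg hη.le 6)]

/-- ★★ **THE CURVATURE IS η-UNIFORM**: `pauliCurvScaled α β η → 2αβ` as `η → 0⁺` (`α, β ≥ 0`). [cite: King1986, (2.12) p.653, (4.38) p.674] -/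
theorem tendsto_pauliCurvScaled {α β : ℝ} (hα : 0 ≤ α) (hβ : 0 ≤ β) : Tendsto (fun η : ℝ => pauliCurvScaled α β η) (𝓝[>] 0) (𝓝 (2 * α * β)) := by
  have hmaj : Tendsto (fun η : ℝ => (α ^ 3 * β + α * β ^ 3) * η ^ 2 / 3) (𝓝[>] 0) (𝓝 0) := by
    have hc : Continuous fun η : ℝ => (α ^ 3 * β + α * β ^ 3) * η ^ 2 / 3 := by continuity
    have h := hc.tendsto 0
    simp only [zero_pow (by norm_num : (2 : ℕ) ≠ 0), mul_zero, zero_div] at h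
    exact tendsto_nhdsWithin_of_tendsto_nhds h
  have hev : ∀ᶠ η : ℝ in 𝓝[>] 0, 0 < η ∧ α * η ≤ 1 ∧ β * η ≤ 1 := by
    have h1 : ∀ᶠ η : ℝ in 𝓝[>] 0, 0 < η := self_mem_nhdsWithin
    have h2 : ∀ᶠ η : ℝ in 𝓝 (0 : ℝ), α * η ≤ 1 ∧ β * η ≤ 1 := by
      have hca : Continuous fun η : ℝ => α * η := by continuity
      have hcb : Continuous fun η : ℝ => β * η := by continuity
      have hta := hca.tendsto 0; have htb := hcb.tendsto 0
      simp only [mul_zero] at hta htb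
      exact (hta.eventually (eventually_le_nhds zero_lt_one)).and (htb.eventually (eventually_le_nhds zero_lt_one))
    exact h1.and (mem_nhdsWithin_of_mem_nhds h2)
  have hbound : ∀ᶠ η : ℝ in 𝓝[>] 0, ‖pauliCurvScaled α β η - 2 * α * β‖ ≤ (α ^ 3 * β + α * β ^ 3) * η ^ 2 / 3 :=
    hev.mono fun η h => by
      rw [Real.norm_eq_abs, abs_le]
      constructor
      · have := pauliCurvScaled_ge hα hβ h.1 h.2.1 h.2.2; linarith
      · have := pauliCurvScaled_le hα hβ h.1; have : 0 ≤ (α ^ 3 * β + α * β ^ 3) * η ^ 2 / 3 := by positivity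
        linarith
  have h := squeeze_zero_norm' hbound hmaj
  rw [← tendsto_sub_nhds_zero_iff]; exact h

/-- ★★ **PART Ϳ's PLAQUETTE MASS IN PHYSICAL UNITS IS `O(η²)`**: `2η⁻²·λ(1 − 2sin²αη·sin²βη) ≤ 2α²β²η²` (Ϸ-d `pauli_plaq_road_le` + `sin²x ≤ x²`).
[cite: DodziukMathai2006, Cor 1.3 §1; King1986, (2.12) p.653, (4.4) p.670] -/
theorem pauli_plaq_road_scaled_le {α β η : ℝ} (hη : 0 < η) :
    2 * η⁻¹ ^ 2 * plaqGap (1 - 2 * Real.sin (α * η) ^ 2 * Real.sin (β * η) ^ 2) ≤ 2 * α ^ 2 * β ^ 2 * η ^ 2 := by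
  have h := pauli_plaq_road_le (by positivity : (0 : ℝ) ≤ η⁻¹ ^ 2) (α * η) (β * η)
  have ha := sin_sq_le_sq (α * η); have hb := sin_sq_le_sq (β * η)
  have hη2 : 0 < η ^ 2 := by positivity
  have hprod : Real.sin (α * η) ^ 2 * Real.sin (β * η) ^ 2 ≤ (α * η) ^ 2 * (β * η) ^ 2 := mul_le_mul ha hb (sq_nonneg _) (by positivity)
  calc 2 * η⁻¹ ^ 2 * plaqGap (1 - 2 * Real.sin (α * η) ^ 2 * Real.sin (β * η) ^ 2) ≤ 2 * η⁻¹ ^ 2 * (Real.sin (α * η) ^ 2 * Real.sin (β * η) ^ 2) := h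
    _ ≤ 2 * η⁻¹ ^ 2 * ((α * η) ^ 2 * (β * η) ^ 2) := mul_le_mul_of_nonneg_left hprod (by positivity)
    _ = 2 * α ^ 2 * β ^ 2 * η ^ 2 := by rw [inv_pow]; field_simp

/-- ★ … hence it VANISHES in the continuum limit: `2η⁻²λ(1 − 2sin²αη sin²βη) → 0` (squeezed between `0` and `2α²β²η²`). [cite: DodziukMathai2006, Cor 1.3 §1; King1986, (4.38) p.674] -/
theorem tendsto_pauli_plaq_road_scaled (α β : ℝ) :
    Tendsto (fun η : ℝ => 2 * η⁻¹ ^ 2 * plaqGap (1 - 2 * Real.sin (α * η) ^ 2 * Real.sin (β * η) ^ 2)) (𝓝[>] 0) (𝓝 0) := by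
  have hmaj : Tendsto (fun η : ℝ => 2 * α ^ 2 * β ^ 2 * η ^ 2) (𝓝[>] 0) (𝓝 0) := by
    have hc : Continuous fun η : ℝ => 2 * α ^ 2 * β ^ 2 * η ^ 2 := by continuity
    have h := hc.tendsto 0
    simp only [zero_pow (by norm_num : (2 : ℕ) ≠ 0), mul_zero] at h
    exact tendsto_nhdsWithin_of_tendsto_nhds h
  have hpos : ∀ᶠ η : ℝ in 𝓝[>] 0, 0 < η := self_mem_nhdsWithin
  have hnonneg : ∀ η : ℝ, 0 ≤ 2 * η⁻¹ ^ 2 * plaqGap (1 - 2 * Real.sin (α * η) ^ 2 * Real.sin (β * η) ^ 2) := fun η => by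
    have h1 : 1 - 2 * Real.sin (α * η) ^ 2 * Real.sin (β * η) ^ 2 ≤ 1 := by nlinarith [sq_nonneg (Real.sin (α * η) * Real.sin (β * η))]
    have := Curvature.plaqGap_nonneg h1
    positivity
  have hbound : ∀ᶠ η : ℝ in 𝓝[>] 0, ‖2 * η⁻¹ ^ 2 * plaqGap (1 - 2 * Real.sin (α * η) ^ 2 * Real.sin (β * η) ^ 2)‖ ≤ 2 * α ^ 2 * β ^ 2 * η ^ 2 :=
    hpos.mono fun η h => by rw [Real.norm_eq_abs, abs_of_nonneg (hnonneg η)]; exact pauli_plaq_road_scaled_le h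
  exact squeeze_zero_norm' hbound hmaj

end Curvature

/-! ## §5 The exact eigenvalue in the limit; the isotropic pair meets the abelian Landau floor -/

section Limit

/-- ★★★ **THE EXACT EIGENVALUE IN THE CONTINUUM LIMIT**: `η⁻²·2(1 − cos(βη)) → β²` as `η → 0⁺` (`β ≥ 0`) — PART Ϸ-e's eigenvalue `c·2(1−cos b)` in physical units.  With
`tendsto_pauliScaled` the continuum mass of the weaker link is pinned at `β² = min(α,β)²` from BOTH sides. [cite: King1986, (4.38) p.674, (4.4) p.670] -/
theorem tendsto_scaled_exact {β : ℝ} (hβ : 0 ≤ β) : Tendsto (fun η : ℝ => η⁻¹ ^ 2 * (2 * (1 - Real.cos (β * η)))) (𝓝[>] 0) (𝓝 (β ^ 2)) := by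
  have hmaj : Tendsto (fun η : ℝ => 5 * β ^ 4 * η ^ 2 / 48) (𝓝[>] 0) (𝓝 0) := by
    have hc : Continuous fun η : ℝ => 5 * β ^ 4 * η ^ 2 / 48 := by continuity
    have h := hc.tendsto 0
    simp only [zero_pow (by norm_num : (2 : ℕ) ≠ 0), mul_zero, zero_div] at h
    exact tendsto_nhdsWithin_of_tendsto_nhds h
  have hev : ∀ᶠ η : ℝ in 𝓝[>] 0, 0 < η ∧ β * η ≤ 1 := by
    have h1 : ∀ᶠ η : ℝ in 𝓝[>] 0, 0 < η := self_mem_nhdsWithin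
    have h2 : ∀ᶠ η : ℝ in 𝓝 (0 : ℝ), β * η ≤ 1 := by
      have hcb : Continuous fun η : ℝ => β * η := by continuity
      have htb := hcb.tendsto 0
      simp only [mul_zero] at htb
      exact htb.eventually (eventually_le_nhds zero_lt_one)
    exact h1.and (mem_nhdsWithin_of_mem_nhds h2)
  have hbound : ∀ᶠ η : ℝ in 𝓝[>] 0, ‖η⁻¹ ^ 2 * (2 * (1 - Real.cos (β * η))) - β ^ 2‖ ≤ 5 * β ^ 4 * η ^ 2 / 48 :=
    hev.mono fun η h => by rw [Real.norm_eq_abs]; exact abs_scaled_two_mul_one_sub_cos_sub_le hβ h.1 h.2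
  have h := squeeze_zero_norm' hbound hmaj
  rw [← tendsto_sub_nhds_zero_iff]; exact h

/-- ★★ **THE ISOTROPIC PAIR MEETS THE ABELIAN LANDAU FLOOR**: for `α = β ≥ 0` the Pauli floor `pauliScaled α α η → α²` AND PART Ϡ-d's abelian floor `η⁻²Λ(Bη²) → B∕2` at the SAME
physical curvature `B = 2α²` also tends to `α²` — «curvature as mass, linearly, at half the Landau rate» holds alike for the abelian flux and the non-abelian constant pair.
[cite: King1986, (4.4) p.670, (4.38) p.674; Balaban1985BackgroundPropagators, (3.35) p.396] -/
theorem pauli_isotropic_meets_landau {α : ℝ} (hα : 0 ≤ α) :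
    Tendsto (fun η : ℝ => pauliScaled α α η) (𝓝[>] 0) (𝓝 (α ^ 2))
    ∧ Tendsto (fun η : ℝ => η⁻¹ ^ 2 * landauGap (2 * α ^ 2 * η ^ 2)) (𝓝[>] 0) (𝓝 (α ^ 2)) := by
  refine ⟨?_, ?_⟩
  · have h := tendsto_pauliScaled hα hα
    rwa [min_self] at h
  · have h := tendsto_landauScaled (B := 2 * α ^ 2) (by positivity)
    have h2 : 2 * α ^ 2 / 2 = α ^ 2 := by ring
    rw [h2] at h
    refine h.congr' (Eventually.of_forall fun η => ?_)
    ring_nf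

end Limit

end Summit.QuantumFields.YangMills.BalabanUVNodes.N15KingModelRung.ConstantCurvature

end
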